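import Literature.MathematicalPhysics.PowerSystems.DVOCCollectiveAmplitudeRegion
import Literature.MathematicalPhysics.PowerSystems.DVOCReducedConvergence
import Literature.Analysis.ODE.GlobalExistence
import Literature.Analysis.ODE.ConfinedAutonomous
import HarnessLib

/-!
# Global solutions from the collective-amplitude band `Ω₃` of the reduced dVOC network, and the packaged
# regional statement «from every state of `Ω₃` a solution of (17) exists on every `[0, T]`, stays in `Ω₃`,
# synchronises at rate `2ηc` and its collective amplitude tends to `1` at rate `min(2ηαρ², 2ηc)`»
# (Groß–Colombino–Brouillon–Dörfler 2019, model (17); Colombino–Groß–Brouillon–Dörfler 2019, Claim 1)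

Topic `Literature/MathematicalPhysics/PowerSystems`, namespace
`Literature.MathematicalPhysics.PowerSystems.DvocReduced`; fifth «collective-amplitude» module
(`Gate` → `Dynamics` → `Barrier` → `Region` → **`WellPosed`**). MODELLED column: statements about the
printed reduced-order model (17), `M = DvocReduced N`; nothing here says that a converter, feeder or grid
is stable; the band `Ω₃ = {½‖P_Sv‖² ≤ d²/2} ∩ {ρ² ≤ r² ≤ ρ₊²}` is an INNER region, O(1) in `N`;
sufficient, not necessary. 0 named facts, 0 `decide`, instance-free; every statement PROVED. Answers
gridfusion-g2-crit-1's condition (g6) (STATUS l.10675: the `Region` module's theorems are a priori —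
«every solution defined on `[0, T]` obeys …» — «until a global-existence lemma (polynomial field +
forward-invariant compact `Ω₃`; routine, untyped) is added»): here it is added, from the tree's
continuation principle `Literature.Analysis.ODE.exists_solution_of_apriori_bound` (a priori bound =
forward invariance of the BOUNDED band, `region_invariant₃`) and the tree's `contDiff_field` ((17) is
polynomial, hence Lipschitz on compact sets, `Literature.Analysis.ODE.exists_lipschitzOnWith_of_isCompact`).
Cell G2-SCALE lead §58 D74 (idea card «idea-2 (cycle 5) / collective-amplitude-gate-printed-gain-
certificate»); typed by gridfusion-lit-4 (g15), 2026-08-28.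

## Sources (read on the page)

* [GrossEtAl2019] arXiv:1802.08881 = IEEE TCNS 6 (2019) 1148: model (17) p0006 L9–16; Theorem 2 p0005
  L69–76; §III Thm. 1 p0004 L108–124 (the flow `φ_f(t, x₀)` of a Lipschitz field, «for all t ∈ ℝ_{>0}»).
* [ColombinoEtAl2019] arXiv:1710.00694 = IEEE TAC 64 (2019) 4496: proof of Claim 1, chunk p0016 «The
  trajectories φ_f̄(t, v̄₀) are well-defined for all times t ∈ ℝ_{≥0} and all initial conditions v̄₀ ∈ ℝⁿ.
  Moreover, because f̄ is continuously differentiable, the map … is continuous»; Prop. 9 chunk p0015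
  L42–50 (boundedness of trajectories via compact invariant sets `𝒲_k`); Prop. 11 chunk p0017 L28–32
  (invariant neighbourhood `ℳ(γ_𝒜)` of `𝒯`).
* Continuation principle: [Teschl2012, Cor. 2.16] as typed in the tree's `GlobalExistence.lean`.

## What is printed and what is this file's

PRINTED: global existence of the reduced flow for ALL initial states ([ColombinoEtAl2019, Claim 1]; in
the tree under the full-gain hypotheses of Prop. 3 as `DvocReduced.exists_isSolutionOn`, via the GLOBAL
Lyapunov function (19)). THIS FILE: WITHOUT any global decrease hypothesis — only the `Region` module's
regional data (symmetric `w`, `v_k⋆ ≥ v_min > 0`, `α ≥ 0`, `η > 0`, `c > 0`, loading enclosure `Σ̄`,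
`GateDecrease c (ε₁ + ℓ/(4v_min²))` at the REDUCED gain, the two polynomial brackets of the faces
`r² = ρ²`, `r² = ρ₊²`) — (i) the band is bounded in the sup norm, `|v_k^{(i)}| ≤ √(2(ρ₊²Λ + d²))`
(`abs_coord_le_of_mem_band`); (ii) from every `x₀ ∈ Ω₃` a solution of (17) exists on every `[0, T]`
(`exists_isSolutionOn_of_mem_band`); (iii) packaged: such a solution stays in `Ω₃`, satisfies
`‖v(t)‖²_S ≤ e^{−2ηct}‖v(0)‖²_S` and, for `α > 0`, `ρ > 0`, `c < αρ²`, the amplitude bound of `amp_sq_decay`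
for all `t ≥ 0` (`exists_solution_band_sync`). Uniqueness is not restated (Grönwall, as in the tree's
`isSolutionOn_unique`, applies verbatim inside the compact band). Nothing in this file certifies a real grid.
-/

noncomputable section

namespace Literature.MathematicalPhysics.PowerSystems

open Finset Real Set Metric

namespace DvocReduced

variable {N : ℕ} (W : DvocReduced N)

/-- **The band is bounded, coordinatewise**: if `½‖P_Sv‖² ≤ d²/2` and `r(v)² ≤ ρ₊²` then every coordinate
satisfies `(v_k^{(i)})² ≤ 2(ρ₊²Λ + d²)` (`v = s(v) + P_Sv`, `‖s(v)_k‖² = r²v_k⋆² ≤ ρ₊²Λ`,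
`‖(P_Sv)_k‖² ≤ ‖v‖²_S ≤ d²`) — the compactness half of «polynomial field + forward-invariant compact band».
[cite: ColombinoEtAl2019, Prop. 9 chunk p0015 L42–50 (bounded trajectories via compact invariant sets)] -/
theorem coord_sq_le_of_mem_band (hΛ : W.Lam ≠ 0) {ρp d : ℝ} (v : DvocState N)
    (hV : 1 / 2 * W.normS2 v ≤ d ^ 2 / 2) (hrp : W.rSq v ≤ ρp ^ 2) (k : Fin N) :
    v.1 k ^ 2 ≤ 2 * (ρp ^ 2 * W.Lam + d ^ 2) ∧ v.2 k ^ 2 ≤ 2 * (ρp ^ 2 * W.Lam + d ^ 2) := by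
  obtain ⟨e1, e2⟩ := W.syncPart_add_projS v k
  have hs := W.nsq_syncPart v k
  have hδ := W.nsq_projS_le_normS2 hΛ v k
  unfold dvocNsq at hs hδ
  have hvk : W.vref k ^ 2 ≤ W.Lam :=
    Finset.single_le_sum (f := fun j => W.vref j ^ 2) (fun j _ => sq_nonneg _) (Finset.mem_univ k)
  have hr0 : 0 ≤ W.rSq v := by unfold rSq; positivity
  have hsb : (W.syncPart v).1 k ^ 2 + (W.syncPart v).2 k ^ 2 ≤ ρp ^ 2 * W.Lam := by
    rw [hs]
    calc W.rSq v * W.vref k ^ 2 ≤ ρp ^ 2 * W.vref k ^ 2 :=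
          mul_le_mul_of_nonneg_right hrp (sq_nonneg _)
      _ ≤ ρp ^ 2 * W.Lam := mul_le_mul_of_nonneg_left hvk (sq_nonneg _)
  have hδb : (W.projS v).1 k ^ 2 + (W.projS v).2 k ^ 2 ≤ d ^ 2 := by linarith
  constructor
  · rw [← e1]
    nlinarith [sq_nonneg ((W.syncPart v).1 k - (W.projS v).1 k), sq_nonneg ((W.syncPart v).2 k),
      sq_nonneg ((W.projS v).2 k)]
  · rw [← e2]
    nlinarith [sq_nonneg ((W.syncPart v).2 k - (W.projS v).2 k), sq_nonneg ((W.syncPart v).1 k),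
      sq_nonneg ((W.projS v).1 k)]

/-- **Sup-norm bound on the band**: `‖v‖ ≤ √(2(ρ₊²Λ + d²))` for every state with `½‖P_Sv‖² ≤ d²/2` and
`r(v)² ≤ ρ₊²` (the norm of `DvocState N = (Fin N → ℝ) × (Fin N → ℝ)` is the max of the two sup norms).
[cite: ColombinoEtAl2019, Prop. 9 chunk p0015 L42–50] -/
theorem norm_le_of_mem_band (hΛ : W.Lam ≠ 0) {ρp d : ℝ} (v : DvocState N)
    (hV : 1 / 2 * W.normS2 v ≤ d ^ 2 / 2) (hrp : W.rSq v ≤ ρp ^ 2) :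
    ‖v‖ ≤ Real.sqrt (2 * (ρp ^ 2 * W.Lam + d ^ 2)) := by
  have hR : 0 ≤ Real.sqrt (2 * (ρp ^ 2 * W.Lam + d ^ 2)) := Real.sqrt_nonneg _
  have h := fun k => W.coord_sq_le_of_mem_band hΛ v hV hrp k
  rw [Prod.norm_def, max_le_iff, pi_norm_le_iff_of_nonneg hR, pi_norm_le_iff_of_nonneg hR]
  exact ⟨fun k => by rw [Real.norm_eq_abs]; exact Real.abs_le_sqrt (h k).1,
    fun k => by rw [Real.norm_eq_abs]; exact Real.abs_le_sqrt (h k).2⟩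

/-- **Global existence from the band `Ω₃`** (answers the a-priori caveat of the `Region` module): under the
hypotheses of `region_invariant₃` — symmetric weights, `v_k⋆ ≥ v_min > 0`, `α ≥ 0`, `η > 0`, `c > 0`, the
loading enclosure `Σ_k(σ_k/v_k⋆)² ≤ Σ̄²`, the reduced-gain inequality `GateDecrease c ((1 − ρ²) + (d²/2)/(4v_min²))`,
a positive lower bracket and a negative upper bracket — from EVERY `x₀` with `½‖P_Sx₀‖² ≤ d²/2` and
`ρ² ≤ r(x₀)² ≤ ρ₊²` there is `γ` with `γ 0 = x₀` solving (17) on every `[0, T]` (tree convention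
`IsSolutionOn γ (Icc 0 T)`). Proof: (17) is `C¹` (`contDiff_field`), hence Lipschitz on closed balls; every
solution issued from `x₀` on `[0, s]` stays in the band (`region_invariant₃`), which lies in the ball of
radius `√(2(ρ₊²Λ + d²))`; continuation (`Literature.Analysis.ODE.exists_solution_of_apriori_bound`).
[cite: ColombinoEtAl2019, proof of Claim 1 chunk p0016 («the trajectories … are well-defined for all times»); GrossEtAl2019 (17) p0006 L9–16] -/
theorem exists_isSolutionOn_of_mem_band (hΛ : W.Lam ≠ 0) (hw : ∀ k j, W.w k j = W.w j k) (hα : 0 ≤ W.α)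
    (hη : 0 < W.η) {vmin ρ ρp d Sb c : ℝ} (hvmin : 0 < vmin) (hv : ∀ k, vmin ≤ W.vref k)
    (hρ : 0 ≤ ρ) (hρp : 0 ≤ ρp) (hd : 0 < d) (hSb : 0 ≤ Sb)
    (hσ : ∑ k, (W.loadSig k / W.vref k) ^ 2 ≤ Sb ^ 2) (hc : 0 < c)
    (hBpos : 0 < W.α * (ρ ^ 2 * ((1 - ρ ^ 2) * W.Lam - 3 * d ^ 2) - ρ * d ^ 3 / vmin)
      - 2 * ρ * d * Sb)
    (hBup : W.α * (ρp ^ 2 * ((1 - ρp ^ 2) * W.Lam) + ρp * d ^ 3 / vmin) + 2 * ρp * d * Sb < 0)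
    (h23 : W.GateDecrease c ((1 - ρ ^ 2) + d ^ 2 / 2 / (4 * vmin ^ 2)))
    {x₀ : DvocState N} (h0V : 1 / 2 * W.normS2 x₀ ≤ d ^ 2 / 2) (h0r : ρ ^ 2 ≤ W.rSq x₀)
    (h0rp : W.rSq x₀ ≤ ρp ^ 2) :
    ∃ γ : ℝ → DvocState N, γ 0 = x₀ ∧ ∀ T : ℝ, W.IsSolutionOn γ (Set.Icc 0 T) := by
  set R : ℝ := Real.sqrt (2 * (ρp ^ 2 * W.Lam + d ^ 2)) with hRdef
  have hlip : ∀ T ρ' : ℝ, ∃ K : NNReal, ∀ t ∈ Icc 0 T,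
      LipschitzOnWith K ((fun _ : ℝ => W.field) t) (closedBall 0 ρ') := by
    intro T ρ'
    obtain ⟨K, hK⟩ := Literature.Analysis.ODE.exists_lipschitzOnWith_of_isCompact isOpen_univ
      W.contDiff_field.contDiffOn (isCompact_closedBall (0 : DvocState N) ρ') (subset_univ _)
    exact ⟨K, fun _ _ => hK⟩
  have hcont : ∀ x : DvocState N, ContinuousOn (fun t : ℝ => (fun _ : ℝ => W.field) t x) (Ici 0) :=
    fun _ => continuousOn_const
  have hapriori : ∀ T : ℝ, 0 ≤ T → ∃ R' : ℝ, ‖x₀‖ ≤ R' ∧ ∀ s ∈ Icc 0 T, ∀ β : ℝ → DvocState N,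
      β 0 = x₀ → (∀ t ∈ Icc 0 s, HasDerivWithinAt β ((fun _ : ℝ => W.field) t (β t)) (Icc 0 s) t) →
      ∀ t ∈ Icc 0 s, ‖β t‖ ≤ R' := by
    intro T _
    refine ⟨R, W.norm_le_of_mem_band hΛ x₀ h0V h0rp, fun s _ β hβ0 hβ t ht => ?_⟩
    have hsol : W.IsSolutionOn β (Set.Icc 0 s) := fun τ hτ => hβ τ hτ
    have hband := W.region_invariant₃ hΛ hw hα hη hvmin hv hρ hρp hd hSb hσ hc hBpos hBup h23 hsol
      (by rw [hβ0]; exact h0V) (by rw [hβ0]; exact h0r) (by rw [hβ0]; exact h0rp) t ht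
    exact W.norm_le_of_mem_band hΛ (β t) hband.1 hband.2.2
  obtain ⟨γ, hγ0, hγ⟩ := Literature.Analysis.ODE.exists_solution_of_apriori_bound
    (v := fun _ : ℝ => W.field) (x₀ := x₀) hlip hcont hapriori
  exact ⟨γ, hγ0, fun T t ht => hγ T t ht⟩

/-- **Packaged regional statement (existence + invariance + both rates).** Under the hypotheses of
`amp_sq_decay` (those of `region_invariant₃` with `α > 0`, `ρ > 0`, `c < αρ²`), from EVERY `x₀ ∈ Ω₃` there is
a solution `γ` of (17) with `γ 0 = x₀`, defined on every `[0, T]`, which for all `t ≥ 0` stays in `Ω₃`,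
satisfies `‖γ(t)‖²_S ≤ e^{−2ηct}‖x₀‖²_S` and
`(1 − r(γ t)²)² ≤ e^{−2ηαρ²t}(1 − r(x₀)²)² + K_r/(αρ²Λ²(αρ² − c))·e^{−2ηct}‖x₀‖²_S` — exponential approach
to `𝒯 = 𝒮 ∩ 𝒜` from the O(1)-in-`N` band, at the REDUCED-gain inequality, for every `N`. MODELLED model
(17), uniform `α`, inner region; printed counterparts are Thm 2 (almost global, full-gain Condition 2, no
rate) and [ColombinoEtAl2019, Prop. 11 / Claim 1]. [cite: GrossEtAl2019, Thm 2 p0005 L69–76 and (17) p0006 L9–16] -/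
theorem exists_solution_band_sync (hΛ : W.Lam ≠ 0) (hw : ∀ k j, W.w k j = W.w j k) (hα : 0 < W.α)
    (hη : 0 < W.η) {vmin ρ ρp d Sb c : ℝ} (hvmin : 0 < vmin) (hv : ∀ k, vmin ≤ W.vref k)
    (hρ : 0 < ρ) (hρp : 0 ≤ ρp) (hd : 0 < d) (hSb : 0 ≤ Sb)
    (hσ : ∑ k, (W.loadSig k / W.vref k) ^ 2 ≤ Sb ^ 2) (hc : 0 < c) (hcα : c < W.α * ρ ^ 2)
    (hBpos : 0 < W.α * (ρ ^ 2 * ((1 - ρ ^ 2) * W.Lam - 3 * d ^ 2) - ρ * d ^ 3 / vmin)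
      - 2 * ρ * d * Sb)
    (hBup : W.α * (ρp ^ 2 * ((1 - ρp ^ 2) * W.Lam) + ρp * d ^ 3 / vmin) + 2 * ρp * d * Sb < 0)
    (h23 : W.GateDecrease c ((1 - ρ ^ 2) + d ^ 2 / 2 / (4 * vmin ^ 2)))
    {x₀ : DvocState N} (h0V : 1 / 2 * W.normS2 x₀ ≤ d ^ 2 / 2) (h0r : ρ ^ 2 ≤ W.rSq x₀)
    (h0rp : W.rSq x₀ ≤ ρp ^ 2) :
    ∃ γ : ℝ → DvocState N, γ 0 = x₀ ∧ (∀ T : ℝ, W.IsSolutionOn γ (Set.Icc 0 T)) ∧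
      ∀ t : ℝ, 0 ≤ t →
        (1 / 2 * W.normS2 (γ t) ≤ d ^ 2 / 2 ∧ ρ ^ 2 ≤ W.rSq (γ t) ∧ W.rSq (γ t) ≤ ρp ^ 2) ∧
        W.normS2 (γ t) ≤ Real.exp (-(2 * W.η * c * t)) * W.normS2 x₀ ∧
        (1 - W.rSq (γ t)) ^ 2
          ≤ Real.exp (-(2 * (W.η * W.α * ρ ^ 2) * t)) * (1 - W.rSq x₀) ^ 2
            + 3 * ((W.α * ρp ^ 2 * d) ^ 2 + (W.α * (2 * ρp ^ 2 + ρp * d / vmin) * d) ^ 2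
                + (2 * Sb * ρp) ^ 2) / (W.α * ρ ^ 2 * W.Lam ^ 2 * (W.α * ρ ^ 2 - c))
              * Real.exp (-(2 * W.η * c * t)) * W.normS2 x₀ := by
  obtain ⟨γ, hγ0, hγ⟩ := W.exists_isSolutionOn_of_mem_band hΛ hw hα.le hη hvmin hv hρ.le hρp hd hSb
    hσ hc hBpos hBup h23 h0V h0r h0rp
  have h0V' : 1 / 2 * W.normS2 (γ 0) ≤ d ^ 2 / 2 := by rw [hγ0]; exact h0V
  have h0r' : ρ ^ 2 ≤ W.rSq (γ 0) := by rw [hγ0]; exact h0r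
  have h0rp' : W.rSq (γ 0) ≤ ρp ^ 2 := by rw [hγ0]; exact h0rp
  refine ⟨γ, hγ0, hγ, fun t ht => ?_⟩
  have htI : t ∈ Set.Icc (0 : ℝ) t := ⟨ht, le_rfl⟩
  refine ⟨W.region_invariant₃ hΛ hw hα.le hη hvmin hv hρ.le hρp hd hSb hσ hc hBpos hBup h23 (hγ t)
      h0V' h0r' h0rp' t htI, ?_, ?_⟩
  · have h := W.region_exp_decay hΛ hw hα.le hη hvmin hv hρ.le hd hSb hσ hc hBpos h23 (hγ t) h0V' h0r' htI
    rwa [hγ0] at h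
  · have h := W.amp_sq_decay hΛ hw hα hη hvmin hv hρ hρp hd hSb hσ hc hcα hBpos hBup h23 (hγ t)
      h0V' h0r' h0rp' htI
    rwa [hγ0] at h

end DvocReduced

end Literature.MathematicalPhysics.PowerSystems
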